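import Summits.CriticalPhenomena.PercolationContinuityZ3.Theorems.Transplant.SkelPhiStepINegO
import Summits.CriticalPhenomena.PercolationContinuityZ3.Theorems.Transplant.SkelNeg1Closure
import HarnessLib

/-!
# N1 (the {±1} node): THE CLOSURE TOP WITH ORIENTATION — `PlanarSkeletonNeg.samePDropOfSkeletonNeg₁_of_stepI_runO`: the single-type target follows once LEVEL 1 returns,
# from the ORIENTED Step-I″ records `(D, DT, ori)` of `StepI.exists_stepI_negO` (shear `|h| ≤ 10·n` in the chosen orientation), admissible `Sz`, `SMn` and, at every
# `q ∈ [p/2, p]` where the ORIENTED input family `StepI.eventO` over `indexNP {t} Sz SMn` holds with accuracy `δI` under Φ2, a run-restricted anchored-cells scheme with `KitAtRun`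

`StepI.eventO Φ.φ D DT ori i` = the zone for `i = (t, M, none)`, and for `i = (t, M, some (n, fam, σ, τ))` the piece-link of `(φ, D)` if `ori t M n` else of `(trφ φ, DT)`; each is determined
by finitely many pairs (`edgesO`), so the drop engine `Skelφ.exists_drop_of_inputs_run'` transports the family from `p` to `q`.
builds on p205010 (kernel theorem, internal audit signed; external expert review pending) — nothing here uses p205010; `SamePDropOfSkeletonNeg₁` stays OPEN (conditional assembly).
Lane `prim-bschramm`, seat `prim-bschramm-p3` (gen 8; design owner); helper file (`--supports stmt-CriticalPhenomena-4575`); NEG-SCOPE B.8.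
[cite: KozmaNitzan2024, §1 p. 2 (approach 1); §4 Theorem 6 (pp. 25–31), p. 17] [cite: MartineauTassion2017, §3.3 Lemma 3.7] [this work]
-/

noncomputable section

open MeasureTheory ProbabilityTheory
open scoped ENNReal Classical

namespace Summit.CriticalPhenomena.PercolationContinuityZ3.Theorems.Transplant

open Literature.Probability.Percolation Literature.Probability.LatticeModels SimpleGraph KNCells KNLevels
open Literature.Barriers.CriticalPhenomena (HasExponentialGrowth countable_of_connected_of_locallyFinite)

namespace Skelφ.StepI

variable {V : Type} (G : SimpleGraph V) [G.LocallyFinite] (φ : V → Site 2)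

/-- **The oriented input family**: zones, and at `(t, M, n)` the piece-links of the chosen orientation. [this work] -/
def eventO (D DT : DataN V) (ori : V → ℕ → ℕ → Bool) : IdxN V → Set (BondConfig V)
  | (t, M, none) => UniqZone.zone G (D.Λ t) D.k M
  | (t, M, some (n, fam, σ, τ)) => if ori t M n then eventN G φ D (t, M, some (n, fam, σ, τ)) else eventN G (trφ φ) DT (t, M, some (n, fam, σ, τ))

/-- The finite edge supports of the oriented family. [folklore] -/
def edgesO (D DT : DataN V) (ori : V → ℕ → ℕ → Bool) : IdxN V → Finset (Sym2 V)
  | (t, M, none) => pairsF (D.Λ t M)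
  | (t, M, some (n, fam, σ, τ)) => if ori t M n then edgesN G φ D (t, M, some (n, fam, σ, τ)) else edgesN G (trφ φ) DT (t, M, some (n, fam, σ, τ))

/-- The oriented zone input, unfolded. [folklore] -/
@[simp] theorem eventO_none (D DT : DataN V) (ori : V → ℕ → ℕ → Bool) (t : V) (M : ℕ) : eventO G φ D DT ori (t, M, none) = UniqZone.zone G (D.Λ t) D.k M := rfl

/-- The oriented link input, unfolded. [folklore] -/
theorem eventO_some (D DT : DataN V) (ori : V → ℕ → ℕ → Bool) (t : V) (M n : ℕ) (fam : Fin 2) (σ τ : ℤˣ) :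
    eventO G φ D DT ori (t, M, some (n, fam, σ, τ)) =
      if ori t M n then eventN G φ D (t, M, some (n, fam, σ, τ)) else eventN G (trφ φ) DT (t, M, some (n, fam, σ, τ)) := rfl

/-- Every oriented input is determined by the pairs of its support. [folklore] -/
theorem determinedBy_eventO (D DT : DataN V) (ori : V → ℕ → ℕ → Bool) (i : IdxN V) :
    DeterminedBy (eventO G φ D DT ori i) (↑(edgesO G φ D DT ori i) : Set (Sym2 V)) := by
  obtain ⟨t, M, og⟩ := i
  rcases og with _ | ⟨n, fam, σ, τ⟩
  · exact determinedBy_zone _ _ _ (by rw [edgesO, coe_pairsF])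
  · simp only [eventO, edgesO]
    split_ifs
    · exact determinedBy_eventN G φ D _
    · exact determinedBy_eventN G (trφ φ) DT _

variable {G φ}

/-- **Step I″ with orientation over the pairs index set** (strict inequalities): for admissible `Sz`, `SMn` the ORIENTED family is likely at `p`, and the chosen orientation carries the
geometric clause and the shear bound. [cite: KozmaNitzan2024, §4 p. 17 (Step I)] [this work] -/
theorem exists_stepI_negO_indexP [Countable V] {types : Finset V} (hc : G.Preconnected) (hlip : Lip G φ) (hst : Steps G φ)
    (hfr : Frames G φ types) (hκ : CylConn G φ types) {p : unitInterval} (hC : CylSubcritical G φ types p) (hp0 : 0 < (p : ℝ)) (hp1 : (p : ℝ) < 1)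
    (hU : ∀ᵐ ω ∂bondPercolation G p, numInfiniteClusters ω ≤ 1) {z : V} (hθ : 0 < theta G z p)
    (hneg : ∀ t ∈ types, ∃ ρ : G ≃g G, ρ t = t ∧ ∀ w, φ (ρ w) - φ t = -(φ w - φ t)) {δ : ℝ} (hδ0 : 0 < δ) (hδ1 : δ < 1) (m₀ : ℕ) :
    ∃ (D DT : DataN V) (ori : V → ℕ → ℕ → Bool),
      m₀ ≤ D.k ∧ 1 ≤ D.k ∧ D.k ≤ D.M₀ ∧ D.R = fatRadius hfr hC ∧ D.Λ = fatSeq hfr hC ∧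
      DT.Λ = D.Λ ∧ DT.k = D.k ∧ DT.R = D.R ∧ DT.M₀ = D.M₀ ∧ DT.n₁ = D.n₁ ∧
      (∀ t ∈ types, ∀ M, D.M₀ ≤ M → ∀ n, D.n₁ M ≤ n →
        (ori t M n = true → D.EqGeom G φ t M n ∧ (D.hgt t M n).natAbs ≤ 10 * n) ∧
        (ori t M n = false → DT.EqGeom G (trφ φ) t M n ∧ (DT.hgt t M n).natAbs ≤ 10 * n)) ∧
      ∀ (Sz : Finset ℕ) (SMn : Finset (ℕ × ℕ)), (∀ M ∈ Sz, D.M₀ ≤ M) → (∀ q ∈ SMn, D.M₀ ≤ q.1 ∧ D.n₁ q.1 ≤ q.2) →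
        ∀ i ∈ indexNP types Sz SMn, 1 - δ < (bondPercolation G p).real (eventO G φ D DT ori i) := by
  obtain ⟨D, DT, ori, h1, h2, h3, h4, h5, e1, e2, e3, e4, e5, hz, he⟩ :=
    exists_stepI_negO hc hlip hst hfr hκ hC hp0 hp1 hU hθ hneg (δ := δ / 2) (by positivity) (by linarith) m₀
  refine ⟨D, DT, ori, h1, h2, h3, h4, h5, e1, e2, e3, e4, e5, fun t ht M hM n hn => ?_, fun Sz SMn hSz hSMn i hi => ?_⟩
  · obtain ⟨ha, hb⟩ := he t ht M hM n hn
    exact ⟨fun h => ⟨(ha h).1, (ha h).2.1⟩, fun h => ⟨(hb h).1, (hb h).2.1⟩⟩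
  obtain ⟨ht, hog⟩ := of_mem_indexNP hi
  obtain ⟨t, M, og⟩ := i
  simp only at ht hog
  rcases hog with ⟨hM, rfl⟩ | ⟨q, hq, rfl, fam, σ, τ, rfl⟩
  · have := hz t ht M (hSz M hM); rw [eventO_none]; rw [eventN_none] at this; linarith
  · obtain ⟨ha, hb⟩ := he t ht q.1 (hSMn q hq).1 q.2 (hSMn q hq).2
    rw [eventO_some]
    cases hori : ori t q.1 q.2
    · have := (hb hori).2.2 fam σ τ; simp only [Bool.false_eq_true, ↓reduceIte]; linarith
    · have := (ha hori).2.2 fam σ τ; simp only [↓reduceIte]; linarith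

end Skelφ.StepI

namespace PlanarSkeletonNeg

variable {V : Type} {G : SimpleGraph V} [G.LocallyFinite]

/-- **THE CLOSURE TOP OF THE {±1} NODE WITH ORIENTATION (single type).**  As `samePDropOfSkeletonNeg₁_of_stepI_run`, but LEVEL 1 receives the oriented records `(D, DT, ori)` with the
shear bound `κ ≤ 10` in the chosen orientation and the oriented family `StepI.eventO`. [cite: KozmaNitzan2024, §1 p. 2 (approach 1); §4 Theorem 6 (pp. 25–31), p. 17] [this work] -/
theorem samePDropOfSkeletonNeg₁_of_stepI_runO
    (h : ∀ {V : Type} [DecidableEq V] [Countable V] (G : SimpleGraph V) [G.LocallyFinite] (Φ : PlanarSkeletonNeg G),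
      ¬ HasExponentialGrowth G → ∀ t ∈ Φ.types, Φ.types = {t} → ∀ p : unitInterval, 0 < (p : ℝ) → (p : ℝ) < 1 →
        (∀ᵐ ω ∂bondPercolation G p, numInfiniteClusters ω ≤ 1) → ∀ hC : Φ.CylSubcritical p, 0 < theta G t p →
          ∃ (δI : ℝ) (m₀ : ℕ), 0 < δI ∧ δI < 1 ∧
            ∀ (D DT : Skelφ.StepI.DataN V) (ori : V → ℕ → ℕ → Bool), m₀ ≤ D.k → 1 ≤ D.k → D.k ≤ D.M₀ → D.R = Skelφ.fatRadius Φ.frame hC →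
              D.Λ = Skelφ.fatSeq Φ.frame hC → DT.Λ = D.Λ → DT.k = D.k → DT.R = D.R → DT.M₀ = D.M₀ → DT.n₁ = D.n₁ →
              (∀ M, D.M₀ ≤ M → ∀ n, D.n₁ M ≤ n →
                (ori t M n = true → D.EqGeom G Φ.φ t M n ∧ (D.hgt t M n).natAbs ≤ 10 * n) ∧
                (ori t M n = false → DT.EqGeom G (Skelφ.trφ Φ.φ) t M n ∧ (DT.hgt t M n).natAbs ≤ 10 * n)) →
              ∃ (Sz : Finset ℕ) (SMn : Finset (ℕ × ℕ)), (∀ M ∈ Sz, D.M₀ ≤ M) ∧ (∀ q ∈ SMn, D.M₀ ≤ q.1 ∧ D.n₁ q.1 ≤ q.2) ∧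
                ∀ q : unitInterval, (p : ℝ) / 2 ≤ q → (q : ℝ) ≤ p →
                  (∀ i ∈ Skelφ.StepI.indexNP {t} Sz SMn,
                    1 - δI < (bondPercolation G q).real (Skelφ.StepI.eventO G Φ.φ D DT ori i)) →
                  Φ.CylSubcritical q →
                    ∃ (A : Type) (S : KSchA V A) (FD : FaceData V A) (LD : LevelData V A) (ε' δ₂ : ℝ),
                      S.Γ.root = t ∧ S.p = q ∧
                      RunGeom G S.Γ ∧ AnchGeom S.Γ ∧ SepGeom₂ G S.Γ ∧ ExitGeom G S.Γ ∧ StepsGeom S.Γ FD ∧ LevelGeom G S.Γ FD LD ∧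
                      S.δc ≤ 1 ∧ 0 ≤ ε' ∧ δ₂ ≤ 1 ∧ 4 * ((1 - δ₂) ^ S.Γ.K + ε') ≤ (1 / 2) ^ 32 ∧
                      KSchA.KitAtRun G S FD δ₂ ε') :
    SamePDropOfSkeletonNeg₁ := by
  refine samePDropOfSkeletonNeg₁_of_subexponential_case' fun {V} G _ Φ hg t ht h1 hC => ?_
  haveI : Countable V := countable_of_connected_of_locallyFinite G (Φ.graph_connected t) t
  refine theta_criticalProbIOf_eq_zero_of_drop_at G t fun hθ => ?_
  have hp0 : 0 < ((criticalProbIOf G t : unitInterval) : ℝ) := PlanarSkeletonSign.pos_of_theta_pos hθ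
  have hp1 : ((criticalProbIOf G t : unitInterval) : ℝ) < 1 := Φ.criticalProb_lt_one t
  have hU := Φ.numInfiniteClusters_le_one_neg hg ht (criticalProbIOf G t)
  obtain ⟨δI, m₀, hδI, hδI1, hB⟩ := h G Φ hg t ht h1 _ hp0 hp1 hU hC hθ
  have hC' : Skelφ.CylSubcritical G Φ.φ Φ.types (criticalProbIOf G t) := (Φ.cylSubcritical_iff_skelφ _).1 hC
  obtain ⟨D, DT, ori, hk₀, hk₁, hkM, hR, hΛ, e1, e2, e3, e4, e5, hgeom, hfam⟩ :=
    Skelφ.StepI.exists_stepI_negO_indexP (types := Φ.types) (Φ.graph_connected t).preconnected Φ.lip_skelφ Φ.steps_skelφ Φ.frames_skelφ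
      Φ.cylConn_skelφ hC' hp0 hp1 hU hθ Φ.neg hδI hδI1 m₀
  obtain ⟨Sz, SMn, hSz, hSMn, hq⟩ := hB D DT ori hk₀ hk₁ hkM hR hΛ e1 e2 e3 e4 e5 (fun M hM n hn => hgeom t ht M hM n hn)
  have hfam' := hfam Sz SMn hSz hSMn
  rw [h1] at hfam'
  exact Skelφ.exists_drop_of_inputs_run' (φ := Φ.φ) (types := Φ.types) t hp0 hC'
    (Skelφ.StepI.indexNP {t} Sz SMn) (Skelφ.StepI.eventO G Φ.φ D DT ori) (Skelφ.StepI.edgesO G Φ.φ D DT ori) (fun _ => 1 - δI)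
    (fun i _ => Skelφ.StepI.determinedBy_eventO G Φ.φ D DT ori i) hfam'
    fun q hq1 hq2 hcq hCq => hq q hq1 hq2 hcq ((Φ.cylSubcritical_iff_skelφ q).2 hCq)

end PlanarSkeletonNeg

end Summit.CriticalPhenomena.PercolationContinuityZ3.Theorems.Transplant

end
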